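import Literature.MathematicalPhysics.QuantumFieldTheory.Balaban1983to89.Node00.N03Dossier
import Literature.MathematicalPhysics.QuantumFieldTheory.Balaban1983to89.Node00.Record5C
import Literature.MathematicalPhysics.QuantumFieldTheory.Balaban1983to89.B6Prop26PrintedKLevelFinalV1
import Literature.MathematicalPhysics.QuantumFieldTheory.Balaban1983to89.B6Prop26Census2139OfLastLegsV1

/-!
# NODE N03 · [Balaban1984PropagatorsII] OF RECORD — `Dag.B6_main (leavesP w P)` AT EVERY NODE 00 WORLD OF RECORD (Stage 3) AND AT EVERY
# STAGE-5 RECORD (`IsRecordOfRecord₅`, `IsRecordOfRecord₅C`), EVERY RUN, HYPOTHESIS-FREE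

T. Bałaban, *Propagators and renormalization transformations for lattice gauge theories. II*, Comm. Math. Phys. **96** (1984) 223–250
[Balaban1984PropagatorsII].  TRACK A (YM-PLAN §2b, node N03 of 28), seat `pub-ymgap-dag-p1` = n03-a (prover, KNIT-BY-NAME; HUMAN RULING D-0062).
THEOREMS ONLY, def-free, sorry-free, standard axioms.  The CONVENTIONS OF RECORD block of the root module `Node00.Carriers` applies.

## WHAT THIS FILE IS.  The v1.1 successor of the discharge dossier `Node00.N03Dossier` (p410707): there, §1 displayed the node at every Stage-3 world of
record MODULO EXACTLY the two census slots c3 = (2.138) and c4 = (2.139) of r03's k-level Prop. 2.6 census (section hypotheses `hc3`, `hc4`).  Both slots are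
now TREE THEOREMS — c3: dag-n03-b's `B6Ineq2134DivNormSuppKLevelV1.ineq2138_kLevel_census` (p411356); c4: dag-n02-b's chain `B6Prop26Census2139KLevelV1` ∘
`B6Prop26HolderGrad2KLevelV1` ∘ `B6HolderGrad2NormSuppLegKLevelV1` fed with the last legs `B6LastLegsDivNormSuppKLevelV1.lastLegs_kLevel_of_divLegs ∘ divLegs_kLevel`
(closer `B6Prop26Census2139OfLastLegsV1.prop26_census2139_kLevel`, p412252) — and `B6Prop26PrintedKLevelFinalV1.prop26Printed_kLevel (hb₀) (hb₁) :
B6.Prop26Printed (kGeoG) (kG)` (p412287) is Prop. 2.6 on the genuine k-level census with NO displayed hypothesis (§1 records both slots BY NAME at every `θ`;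
`N03_at_record₃` IS the dossier's `N03_at_record₃_of_slots` specialised to them).  Feeding it to node00-def's Stage-3 ∕ Stage-5 N03 hooks (`Carriers3Leaf.b6_main_of_isWorldOfRecord₃_of_prop26`,
`Record5.b6_main_of_isRecordOfRecord₅_of_prop26`, `Record5C.b6_main_of_isRecordOfRecord₅C_of_prop26`) gives THE NODE OF RECORD:

* `b6BlockParam_D6OfRecord : ∀ θ, θ.toStage1Params.Admissible → DagBinding.B6BlockParam (D6OfRecord θ)` — the leaf `b6` at the k-level tower block of record, OUTRIGHT (all eight legs
  Lemma 2.1 ∕ Props. 2.2, 2.3 ∕ Lemma 2.4 ∕ Props. 2.5, 2.6, 2.7 ∕ Cor. 2.8 by name; the dossier's BOTH-LEGS TABLE);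
* `N03_at_record₃ (w) (hw : IsWorldOfRecord₃ w) (P) : Dag.B6_main (leavesP w P)` — hypotheses: the world-of-record predicate ONLY (and
  `N03_at_record₃_inhabited : ∃ w, IsWorldOfRecord₃ w ∧ ∀ P, Dag.B6_main (leavesP w P)` — INHABITED-AT-3);
* `N03_at_record₅` ∕ `N03_at_record₅C` — the same at every Stage-5 record `IsRecordOfRecord₅ F N D w` ∕ the record predicate OF RECORD `IsRecordOfRecord₅C F N D w`
  (node00-def p410529 ∕ p411316), through `isWorldOfRecord₃_of_isRecordOfRecord₅` ∕ the `b10`-rebinding;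
* the VACUITY GUARD of YM-PLAN §1 (i) in final form: the in-edge leaves `b4`, `b5` HOLD at every world of record (dossier §0, N01 ∕ N02 by name) and are NOT
  consumed — `N03_leaf_b6_at_record₃` proves the node's OWN leaf; non-vacuity of the world-of-record predicate is the dossier's `N03_worldOfRecord₃_exists_dim4_L5`.

Venue re-point (plan ∕ node00-def desk, REPOINT pattern of N04): `N03_holds (w) (hw : Node00.IsWorldOfRecord₃ w) (P) := Node00.N03_at_record₃ w hw P`.

HONEST FRAMING: statement-level skeleton of published theorems with citation tags; proofs where landed; nothing here is a claim about the Yang–Mills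
mass gap.  Kernel bookkeeping over EXISTING tree theorems (one `fun θ hθ => …` per hook); the census is Bałaban's Prop. 2.6 in r03's located reading
(blocks `supp J ⊂ Δ(y′)` = ONE census block, cell GAPS G-B6-2138-SUPP; `C_ε → ∞` as `ε → 0` as printed; V1 tori — the index is inhabited
for `L = 5` (dossier §4: `D = 4`, `L = 5`), EMPTY for `L = 3`, and `L ≥ 7` is not in the tree (`Placed` census, R325 D2), all SAID; the
Track-A count moves only on the chair's booking after the discharge referee's read (R417); one finite T⁴ programme at fixed ε per run — NOT ℝ⁴ ∕ infinite
volume ∕ OS ∕ mass gap ∕ Clay.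
-/

noncomputable section

namespace Literature.MathematicalPhysics.QuantumFieldTheory.Balaban1983to89.Node00

open DagBinding T4Continuum
open B6KLevelCensusIndexV1 (KIdx kGeoG)
open B6Prop26Census2136KLevelV1 (kG)
open B6Prop26PrintedKLevelFinalV1 (prop26Printed_kLevel)
open B6Ineq2134DivNormSuppKLevelV1 (ineq2138_kLevel_census)
open B6Prop26Census2139OfLastLegsV1 (prop26_census2139_kLevel)

/-! ## §1. The census and its two last slots BY NAME at every Stage-3 parameter; the leaf of record OUTRIGHT -/

/-- **Prop. 2.6 on the genuine k-level census at EVERY Stage-3 parameter `θ`** (no admissibility needed: only the band `0 < b₀ ≤ b₁` of `θ` is used) — the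
`h26` input of every node00-def N03 hook, now a term: this seat's Stage 5 `prop26Printed_kLevel` (p412287).
[cite: Balaban1984PropagatorsII, Prop. 2.6 (2.136)–(2.141) p.247] -/
theorem N03_prop26_census (θ : Stage3Params) :
    B6.Prop26Printed (fun i : KIdx θ.d₆ θ.ℓ₆ θ.hd' θ.hL' θ.b₀ θ.b₁ => kGeoG i) (fun i => kG i) :=
  prop26Printed_kLevel θ.hb.1 θ.hb.2

/-- **Slot c3 = (2.138) at `θ`, BY NAME**: dag-n03-b's `ineq2138_kLevel_census` (p411356) — the dossier's section hypothesis `hc3` VERBATIM, now a term.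
[cite: Balaban1984PropagatorsII, Prop. 2.6 (2.138) p.247 (census sub-case supp J ⊂ Δ(y′), cell GAPS G-B6-2138-SUPP)] -/
theorem N03_slot_c3 (θ : Stage3Params) :
    ∃ M₁ δ₃ : ℝ, ∃ Cε : ℝ → ℝ, 0 < M₁ ∧ 0 < δ₃ ∧ ∀ i : KIdx θ.d₆ θ.ℓ₆ θ.hd' θ.hL' θ.b₀ θ.b₁, M₁ ≤ (kGeoG i).M →
      ∀ (ε : ℝ) (J : (kGeoG i).Loc) (y y' : (kGeoG i).Site), 0 < ε → ε < 1 → (kGeoG i).suppIn J y' →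
        (kG i).e4 J y ≤ Cε ε * Real.exp (-(δ₃ * (kGeoG i).dist y y')) * ((kGeoG i).holder ε J + (kGeoG i).supNorm J) :=
  ineq2138_kLevel_census θ.d₆ θ.ℓ₆ θ.hd' θ.hL' θ.hb.1 θ.hb.2

/-- **Slot c4 = (2.139) at `θ`, BY NAME**: dag-n02-b's `prop26_census2139_kLevel` (p412252: `prop26_census2139_kLevel_of_lastLegs` fed with c3 and the last legs
`lastLegs_kLevel_of_divLegs ∘ divLegs_kLevel`; F2 `holderGrad2_pair_kLevel_census`, F3c `holderGrad2Leg0_pair_cube` inside) — the dossier's section hypothesis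
`hc4` VERBATIM, now a term. [cite: Balaban1984PropagatorsII, Prop. 2.6 (2.139) p.247, (2.141) p.247 (census sub-case supp J ⊂ Δ(y′), cell GAPS G-B6-2138-SUPP)] -/
theorem N03_slot_c4 (θ : Stage3Params) :
    ∃ M₁ δ₃ : ℝ, ∃ Cαε : ℝ → ℝ → ℝ, 0 < M₁ ∧ 0 < δ₃ ∧ ∀ i : KIdx θ.d₆ θ.ℓ₆ θ.hd' θ.hL' θ.b₀ θ.b₁, M₁ ≤ (kGeoG i).M →
      ∀ (α ε : ℝ) (J : (kGeoG i).Loc) (ζ : (kGeoG i).Cut) (y y' : (kGeoG i).Site), 0 ≤ α → 0 < ε → α + ε < 1 →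
        (kGeoG i).cutIn ζ y → (kGeoG i).suppIn J y' →
        (kG i).h2 J α ζ ≤ Cαε α ε * ((kGeoG i).len y) ^ (-α) * (kGeoG i).cutH α ζ * Real.exp (-(δ₃ * (kGeoG i).dist y y')) *
          ((kGeoG i).holder (α + ε) J + (kGeoG i).supNorm J) :=
  prop26_census2139_kLevel θ.hb.1 θ.hb.2

/-- **Leg h26 at the block of record, hypothesis-free** — the Prop. 2.6 conjunct of `B6BlockParam (D6OfRecord θ)` itself (`GU` = r03's census `kG` read at
the carrier blocks; the dossier's `N03_leg_h26_of_census` fed with the census theorem): the BOTH-LEGS TABLE of `Node00.N03Dossier` §2 is now complete,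
h21 … h28 all terms. [cite: Balaban1984PropagatorsII, Prop. 2.6 (2.136)–(2.141) p.247] -/
theorem N03_leg_h26 (θ : Stage3Params) : B6.Prop26Printed (D6OfRecord θ).geo (D6OfRecord θ).G :=
  N03_leg_h26_of_census θ (N03_prop26_census θ)

/-- **The B6 leaf at the k-level tower block of record, OUTRIGHT**: `DagBinding.B6BlockParam (D6OfRecord θ)` at every admissible `θ` (Lemma 2.1 in parameter
form ∧ Props. 2.2, 2.3 ∧ Lemma 2.4 ∧ Props. 2.5, 2.6, 2.7 ∧ Cor. 2.8 — the dossier's legs h21–h28 by name, h26 now the census theorem) — the `hleaf` input of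
node00-def's `Carriers3.b6_main_of_isWorldOfRecord₃_of`, as a term.
[cite: Balaban1984PropagatorsII, Lemma 2.1 p.234, Props. 2.2–2.3 pp.234–238, Lemma 2.4 (2.128) p.245, Props. 2.5–2.7 pp.246–249, Cor. 2.8 p.249 (kernel versions at the objects of record)] -/
theorem b6BlockParam_D6OfRecord : ∀ θ : Stage3Params, θ.toStage1Params.Admissible → B6BlockParam (D6OfRecord θ) :=
  fun θ hθ => b6BlockParam_D6OfRecord_of_prop26 θ hθ (N03_prop26_census θ)

/-! ## §2. N03 OF RECORD at the Stage-3 worlds of record -/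

/-- **VACUITY GUARD, conclusion side, final form**: at every Stage-3 world of record the node's OWN leaf `b6` HOLDS — proved from its legs; the in-edge
leaves `b4`, `b5` (which hold there: `N03_antecedent_b4_at_record₃`, `N03_antecedent_b5_at_record₃`) are not consumed.
[cite: Balaban1984PropagatorsII, pp.234–249 (kernel version at the objects of record)] -/
theorem N03_leaf_b6_at_record₃ : ∀ w : WorldP, IsWorldOfRecord₃ w → ∀ P : B12.RunParams, (leavesP w P).b6 :=
  fun w hw P => N03_leaf_b6_at_record₃_of_slots (fun θ _ => N03_slot_c3 θ) (fun θ _ => N03_slot_c4 θ) w hw P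

/-- **N03 · [Balaban1984PropagatorsII] AT EVERY NODE 00 WORLD OF RECORD (Stage 3), EVERY RUN — HYPOTHESES: the world-of-record predicate ONLY**
(venue shape `N03_holds (w) (hw : Node00.IsWorldOfRecord₃ w) (P) : YMDAG.N03 w P`).  The dossier's `N03_at_record₃_of_slots` (p410707) SPECIALISED, exactly as
announced there, to the two named slot closers c3 := `N03_slot_c3` (dag-n03-b), c4 := `N03_slot_c4` (dag-n02-b) — inside: node00-def's
`Carriers3Leaf.b6_main_of_isWorldOfRecord₃_of_prop26` ∘ this seat's Stage 4 `prop26Printed_kLevel_of_slots2`.  No named fact, no displayed slot, no pin; in-edges not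
consumed.  (The Stage-5 spelling `fun w hw P => b6_main_of_isWorldOfRecord₃_of_prop26 (fun θ _ => N03_prop26_census θ) w hw P` is a second proof of the same `Prop`.)
[cite: Balaban1984PropagatorsII, Lemma 2.1 p.234, Props. 2.2–2.3 pp.234–238, Lemma 2.4 p.245, Props. 2.5–2.7 pp.246–249, Cor. 2.8 p.249 — kernel versions of the lineages at the objects of record] -/
theorem N03_at_record₃ (w : WorldP) (hw : IsWorldOfRecord₃ w) (P : B12.RunParams) : Dag.B6_main (leavesP w P) :=
  N03_at_record₃_of_slots (fun θ _ => N03_slot_c3 θ) (fun θ _ => N03_slot_c4 θ) w hw P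

/-- **N03 IN THE STUB SHAPE OF CLUSTER K2** (an explicit record-predicate PARAMETER over (family, datum, world) triples, dagwriter's `AtRecord Rec Dag.B6_main`):
for EVERY record predicate whose world component refines Stage 3, hypothesis-free in the node.
[cite: Balaban1984PropagatorsII, pp.234–249 — kernel version at the objects of record; bookkeeping over the record-predicate parameter] -/
theorem N03_atRecord_of_refines₃ {Fam : Type*} {Dat : Fam → Type*} (Rec : ∀ F : Fam, Dat F → WorldP → Prop)
    (hst : ∀ (F : Fam) (D : Dat F) (w : WorldP), Rec F D w → IsWorldOfRecord₃ w)
    (F : Fam) (D : Dat F) (w : WorldP) (hR : Rec F D w) (P : B12.RunParams) : Dag.B6_main (leavesP w P) :=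
  N03_at_record₃ w (hst F D w hR) P

/-- **All four first-cluster nodes N01 ∧ N02 ∧ N03 ∧ N04 at every Stage-3 world of record, HYPOTHESIS-FREE** (cluster K1 «KnitIR» at Stage 3; node00-def's
`nodes_N01_N02_N03_N04_of_isWorldOfRecord₃_of_prop26` fed with the census theorem).
[cite: Balaban1983RegularityDecay, Theorem p.573; Balaban1984PropagatorsI, Props. 1.1–1.2 pp.33–36; Balaban1984PropagatorsII, pp.223–250; Balaban1985Averaging, Props. 1–10 pp.26–50 (kernel versions of the lineages)] -/
theorem N01_N02_N03_N04_at_record₃ : ∀ w : WorldP, IsWorldOfRecord₃ w → ∀ P : B12.RunParams,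
    Dag.B4_main (leavesP w P) ∧ Dag.B5_main (leavesP w P) ∧ Dag.B6_main (leavesP w P) ∧ Dag.B7_main (leavesP w P) :=
  fun w hw P => nodes_N01_N02_N03_N04_of_isWorldOfRecord₃_of_prop26 (fun θ _ => N03_prop26_census θ) w hw P

/-- **INHABITED-AT-3** (director LINE №22 rider shape): the hypothesis-free node statement is instantiated NON-VACUOUSLY — a Stage-3 world of record EXISTS
(`D = 4`, `L = 5`; the dossier's `N03_worldOfRecord₃_exists_dim4_L5`) and the node holds at it, every run. [cite: Balaban1984PropagatorsII, (2.1)–(2.4) p.224, (2.16) p.225 (parameter dictionary; bookkeeping witness)] -/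
theorem N03_at_record₃_inhabited : ∃ w : WorldP, IsWorldOfRecord₃ w ∧ ∀ P : B12.RunParams, Dag.B6_main (leavesP w P) := by
  obtain ⟨_, w, -, -, -, -, hw, -⟩ := N03_worldOfRecord₃_exists_dim4_L5
  exact ⟨w, hw, N03_at_record₃ w hw⟩

/-! ## §3. N03 OF RECORD at the Stage-5 records (`Record5` literal-`b10` twin and `Record5C`, THE predicate of record) -/

section Stage5

variable {F : T4Family} {N : ℕ} [NeZero N] {D : FiniteEpsData F (SU N)} {w : WorldP}

/-- **N03 at every Stage-5 record `IsRecordOfRecord₅ F N D w`, every run, hypothesis-free** (node00-def's `b6_main_of_isRecordOfRecord₅_of_prop26` fed with the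
census theorem). [cite: Balaban1984PropagatorsII, Lemma 2.1 – Cor. 2.8 pp.234–249 (the stated block at the objects of record)] -/
theorem N03_at_record₅ (h : IsRecordOfRecord₅ F N D w) (P : B12.RunParams) : Dag.B6_main (leavesP w P) :=
  b6_main_of_isRecordOfRecord₅_of_prop26 (fun θ _ => N03_prop26_census θ) h P

/-- **N03 at every Stage-5 record OF RECORD `IsRecordOfRecord₅C F N D w` (the C-binding, chair R434 (Q2) = (C)), every run, hypothesis-free**
(node00-def's `b6_main_of_isRecordOfRecord₅C_of_prop26` fed with the census theorem). [cite: Balaban1984PropagatorsII, Lemma 2.1 – Cor. 2.8 pp.234–249 (the stated block at the objects of record)] -/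
theorem N03_at_record₅C (h : IsRecordOfRecord₅C F N D w) (P : B12.RunParams) : Dag.B6_main (leavesP w P) :=
  b6_main_of_isRecordOfRecord₅C_of_prop26 (fun θ _ => N03_prop26_census θ) h P

/-- **Cluster K1 at every Stage-5 record of record**: N01 ∧ N02 ∧ N03 ∧ N04, hypothesis-free. [cite: Balaban1983RegularityDecay, Theorem p.573; Balaban1984PropagatorsI, Props. 1.1–1.2 pp.33–36; Balaban1984PropagatorsII, pp.223–250; Balaban1985Averaging, Props. 1–10 pp.26–50 (kernel versions of the lineages)] -/
theorem N01_N02_N03_N04_at_record₅C (h : IsRecordOfRecord₅C F N D w) (P : B12.RunParams) :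
    Dag.B4_main (leavesP w P) ∧ Dag.B5_main (leavesP w P) ∧ Dag.B6_main (leavesP w P) ∧ Dag.B7_main (leavesP w P) :=
  ⟨b4_main_of_isRecordOfRecord₅C h P, b5_main_of_isRecordOfRecord₅C h P, N03_at_record₅C h P, b7_main_of_isRecordOfRecord₅C h P⟩

end Stage5

end Literature.MathematicalPhysics.QuantumFieldTheory.Balaban1983to89.Node00

end
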